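import Mathlib.Analysis.SpecialFunctions.Pow.Real
import HarnessLib

/-!
# Route EIHFluxBalance — `InertialRecession` (E′), K1 / stub `stub_coerMomKernel` (Bk), far field, part F4:
# the two triangular kernel eliminations (A) and (B′)

Helper file for the crux `stmt-FinalStateConjecture-17403`. Pure algebra consuming the row tables
`…SlavingFarFieldRowsA/B`, `…SlavingFarFieldSpinRowsA/B` (boost `v = 2s/(1+s²)` along `e₁`, `0 ≤ s < 1`, i.e. `v ≥ 0`
WLOG): **(A)** the boost rows at `3e₁, 3e₂, 3e₃` vanish ⇒ the boost part `b = 0`; **(B′)** the translation + spin rows at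
`3e₁ (j=1,2,3), −3e₂ (j=1), −3e₃ (j=1,2)` vanish (spin weight `a ≠ 0`) ⇒ `d⃗ = 0` and `σ = 0`. These are the far-field
(order `R⁻³`, `R⁻⁴`) steps of Bk. No definitions, no `sorry`. [folklore]
-/

set_option linter.dupNamespace false

namespace Summit.FinalStateConjecture.FinalStateConjecture.Theorems.SublinearIsFree.Slaving

/-- **(A) — boost kernel.** With `G = (1−s²)/(1+s²) = γ⁻¹`, `g = γ`, `0 ≤ s < 1`: the three boost rows
(`P_1`: `(4/9)G³(s²+4s+1)/(1+s)²·b₁`, `Q_2`: `−(8/9)g²v·b₁ + (4/9)g²·b₂`, `A_3`: `−(8/9)g²v·b₁ + (4/9)g²·b₃`) vanish only for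
`b = 0` (lower-triangular with positive pivots). [folklore] -/
theorem farField_boostKernel {s : ℝ} (hs0 : 0 ≤ s) (hs : s < 1) {b₁ b₂ b₃ : ℝ}
    (hP1 : 4 / 9 * ((1 - s ^ 2) / (1 + s ^ 2)) ^ 3 * ((s ^ 2 + 4 * s + 1) / (1 + s) ^ 2) * b₁ = 0)
    (hQ2 : -(8 / 9) * ((1 + s ^ 2) / (1 - s ^ 2)) ^ 2 * (2 * s / (1 + s ^ 2)) * b₁ +
      4 / 9 * ((1 + s ^ 2) / (1 - s ^ 2)) ^ 2 * b₂ = 0)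
    (hA3 : -(8 / 9) * ((1 + s ^ 2) / (1 - s ^ 2)) ^ 2 * (2 * s / (1 + s ^ 2)) * b₁ +
      4 / 9 * ((1 + s ^ 2) / (1 - s ^ 2)) ^ 2 * b₃ = 0) :
    b₁ = 0 ∧ b₂ = 0 ∧ b₃ = 0 := by
  have h1 : 0 < 1 - s ^ 2 := by nlinarith
  have hG : 0 < (1 - s ^ 2) / (1 + s ^ 2) := by positivity
  have hg : 0 < (1 + s ^ 2) / (1 - s ^ 2) := by positivity
  have hb1 : b₁ = 0 := by
    rcases mul_eq_zero.1 hP1 with h | h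
    · exfalso
      have : 0 < 4 / 9 * ((1 - s ^ 2) / (1 + s ^ 2)) ^ 3 * ((s ^ 2 + 4 * s + 1) / (1 + s) ^ 2) := by positivity
      exact this.ne' h
    · exact h
  subst hb1
  have hc : (4 / 9 * ((1 + s ^ 2) / (1 - s ^ 2)) ^ 2 : ℝ) ≠ 0 := by positivity
  refine ⟨rfl, ?_, ?_⟩
  · rw [mul_zero, zero_add] at hQ2
    rcases mul_eq_zero.1 hQ2 with h | h
    · exact absurd h hc
    · exact h
  · rw [mul_zero, zero_add] at hA3
    rcases mul_eq_zero.1 hA3 with h | h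
    · exact absurd h hc
    · exact h

/-- **(B′) — translation + spin kernel.** With `G = γ⁻¹`, `g = γ`, `v = 2s/(1+s²)`, `0 ≤ s < 1` and spin weight `a ≠ 0`:
the six rows `P_1, P_2, P_3, Q′_1, A′_1, A′_2` of `𝓜[Var_d] + a·𝓜[S_σ]` (tables RowsB + SpinRowsA/B) vanish only for
`d⃗ = 0`, `σ = 0` (elimination order `d₁ → σ₃ → σ₂ → d₂ → d₃ → σ₁`). [folklore] -/
theorem farField_translationSpinKernel {s a : ℝ} (hs0 : 0 ≤ s) (hs : s < 1) (ha : a ≠ 0)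
    {d₁ d₂ d₃ σ₁ σ₂ σ₃ : ℝ}
    (hP1 : -(8 / 27) * ((1 - s ^ 2) / (1 + s ^ 2)) ^ 4 * ((1 + s ^ 2) / (1 + s) ^ 2) * d₁ + a * 0 = 0)
    (hP2 : 4 / 27 * ((1 - s ^ 2) / (1 + s ^ 2)) ^ 3 * ((1 + s ^ 2) / (1 + s) ^ 2) * d₂ +
      a * (-(2 / 27) * ((1 - s ^ 2) / (1 + s ^ 2)) ^ 3 * σ₃) = 0)
    (hP3 : 4 / 27 * ((1 - s ^ 2) / (1 + s ^ 2)) ^ 3 * ((1 + s ^ 2) / (1 + s) ^ 2) * d₃ +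
      a * (2 / 27 * ((1 - s ^ 2) / (1 + s ^ 2)) ^ 3 * σ₂) = 0)
    (hQ1 : 4 / 27 * ((1 + s ^ 2) / (1 - s ^ 2)) * d₁ + a * (-(2 / 27) * ((1 + s ^ 2) / (1 - s ^ 2)) * σ₃) = 0)
    (hA1 : 4 / 27 * ((1 + s ^ 2) / (1 - s ^ 2)) * d₁ + a * (2 / 27 * ((1 + s ^ 2) / (1 - s ^ 2)) * σ₂) = 0)
    (hA2 : 4 / 27 * ((1 + s ^ 2) / (1 - s ^ 2)) ^ 2 * d₂ +
      a * (-(2 / 27) * ((1 + s ^ 2) / (1 - s ^ 2)) ^ 2 * σ₁ +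
        2 / 9 * ((1 + s ^ 2) / (1 - s ^ 2)) ^ 2 * (2 * s / (1 + s ^ 2)) * σ₃) = 0) :
    d₁ = 0 ∧ d₂ = 0 ∧ d₃ = 0 ∧ σ₁ = 0 ∧ σ₂ = 0 ∧ σ₃ = 0 := by
  have h1 : 0 < 1 - s ^ 2 := by nlinarith
  have hG : 0 < (1 - s ^ 2) / (1 + s ^ 2) := by positivity
  have hg : 0 < (1 + s ^ 2) / (1 - s ^ 2) := by positivity
  -- d₁ = 0 from P_1
  have hd1 : d₁ = 0 := by
    rw [mul_zero, add_zero] at hP1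
    rcases mul_eq_zero.1 hP1 with h | h
    · exfalso
      have : (0 : ℝ) < 8 / 27 * ((1 - s ^ 2) / (1 + s ^ 2)) ^ 4 * ((1 + s ^ 2) / (1 + s) ^ 2) := by positivity
      linarith
    · exact h
  subst hd1
  -- σ₃ = 0 from Q′_1, σ₂ = 0 from A′_1
  have hσ3 : σ₃ = 0 := by
    have h : a * ((1 + s ^ 2) / (1 - s ^ 2)) * σ₃ = 0 := by linarith
    rcases mul_eq_zero.1 h with h | h
    · rcases mul_eq_zero.1 h with h | h
      · exact absurd h ha
      · exact absurd h hg.ne'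
    · exact h
  have hσ2 : σ₂ = 0 := by
    have h : a * ((1 + s ^ 2) / (1 - s ^ 2)) * σ₂ = 0 := by linarith
    rcases mul_eq_zero.1 h with h | h
    · rcases mul_eq_zero.1 h with h | h
      · exact absurd h ha
      · exact absurd h hg.ne'
    · exact h
  subst hσ3 hσ2
  -- d₂ = 0 from P_2, d₃ = 0 from P_3
  have hc : (4 / 27 * ((1 - s ^ 2) / (1 + s ^ 2)) ^ 3 * ((1 + s ^ 2) / (1 + s) ^ 2) : ℝ) ≠ 0 := by positivity
  have hd2 : d₂ = 0 := by
    have h : 4 / 27 * ((1 - s ^ 2) / (1 + s ^ 2)) ^ 3 * ((1 + s ^ 2) / (1 + s) ^ 2) * d₂ = 0 := by linarith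
    rcases mul_eq_zero.1 h with h | h
    · exact absurd h hc
    · exact h
  have hd3 : d₃ = 0 := by
    have h : 4 / 27 * ((1 - s ^ 2) / (1 + s ^ 2)) ^ 3 * ((1 + s ^ 2) / (1 + s) ^ 2) * d₃ = 0 := by linarith
    rcases mul_eq_zero.1 h with h | h
    · exact absurd h hc
    · exact h
  subst hd2 hd3
  -- σ₁ = 0 from A′_2
  have hσ1 : σ₁ = 0 := by
    have h : a * ((1 + s ^ 2) / (1 - s ^ 2)) ^ 2 * σ₁ = 0 := by linarith
    rcases mul_eq_zero.1 h with h | h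
    · rcases mul_eq_zero.1 h with h | h
      · exact absurd h ha
      · exact absurd h (by positivity)
    · exact h
  exact ⟨rfl, rfl, rfl, hσ1, rfl, rfl⟩

/-- Registered carrier `slaving_farFieldKernel_slaving12` of the crux item (= `farField_boostKernel`). [folklore] -/
theorem slaving_farFieldKernel_slaving12 : ∀ {s : ℝ}, 0 ≤ s → s < 1 → ∀ {b₁ b₂ b₃ : ℝ}, 4 / 9 * ((1 - s ^ 2) / (1 + s ^ 2)) ^ 3 * ((s ^ 2 + 4 * s + 1) / (1 + s) ^ 2) * b₁ = 0 → -(8 / 9) * ((1 + s ^ 2) / (1 - s ^ 2)) ^ 2 * (2 * s / (1 + s ^ 2)) * b₁ + 4 / 9 * ((1 + s ^ 2) / (1 - s ^ 2)) ^ 2 * b₂ = 0 → -(8 / 9) * ((1 + s ^ 2) / (1 - s ^ 2)) ^ 2 * (2 * s / (1 + s ^ 2)) * b₁ + 4 / 9 * ((1 + s ^ 2) / (1 - s ^ 2)) ^ 2 * b₃ = 0 → b₁ = 0 ∧ b₂ = 0 ∧ b₃ = 0 :=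
  farField_boostKernel

end Summit.FinalStateConjecture.FinalStateConjecture.Theorems.SublinearIsFree.Slaving
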